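import Literature.Analysis.FunctionSpaces.MazyaTraceInequality
import Literature.Analysis.FunctionSpaces.MazyaTraceLevelSet
import Literature.Analysis.FunctionSpaces.MazyaTraceLevelSetPoincare
import Literature.Analysis.FunctionSpaces.BoxingInequality
import HarnessLib

/-!
# Maz'ya's trace inequality `∫ g|w| ≤ c K ∫|∇w|` on `ℝ³`: the discharge `MazyaTraceD_holds`

Discharge of the named fact `Literature.Analysis.FunctionSpaces.MazyaTraceD`
(V. G. Maz'ja, *Sobolev Spaces* (1985), §1.4.2, Theorem 2 with Theorem 1, case `q = 1`, `n = 3`,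
`μ = g dx`; file `MazyaTraceInequality.lean`).  The proof is Maz'ya's (level sets, boxing, co-area),
run on the smooth function itself through the level-set perimeter SURROGATE `levelPerimeter` of
`MazyaTraceLevelSet.lean` (no sets of finite perimeter, no co-area formula), and assembled here from

* the **relative isoperimetric inequality in balls**, smooth level-set form
  (`exists_min_measure_superlevel_ball_le_liminf`, file `MazyaTraceLevelSetPoincare.lean`, from the
  `p = 1` Poincaré inequality on balls), instantiated at the steps `η_k = levelStep k` there
  (`exists_nnreal_min_measure_superlevel_ball_le_levelPerimeter`):
  `min(|{u>t} ∩ B(x,r)|, |B(x,r) ∖ {u>t}|) ≤ C₂ r · levelPerimeter u t B(x,r)`;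
* **Gustin's boxing inequality** in abstract form (`setLIntegral_le_of_ballGrowthTwo_of_relIsoperimetric`,
  file `BoxingInequality.lean`: half-density radii + Vitali), instantiated at `Per = levelPerimeter u t`,
  which is superadditive over disjoint balls (`tsum_levelPerimeter_le`):
  `∫_{u>t} g ≤ 8 C₂ K · levelPerimeter u t ℝ³` for `u ∈ C¹_c`, `t > 0` (`setLIntegral_superlevel_le_levelPerimeter`);
* the **co-area inequality for the surrogate** (`lintegral_Ioi_levelPerimeter_univ_le`,
  file `MazyaTraceLevelSet.lean`): `∫₀^∞ levelPerimeter u t ℝ³ dt ≤ ∫ ‖Du‖`;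
* the layer-cake formula `∫ g|w| = ∫₀^∞ μ_g{|w| > t} dt` (Mathlib) and the split
  `{|w| > t} ⊆ {w > t} ∪ {-w > t}` — both `w` and `-w` are smooth with compact support, so no smoothing
  of `|w|` is needed; the price is a factor `2` in the (existential) constant.

No Navier–Stokes statement is proved here: a printed theorem is re-proved so that the named input
`MazyaTraceD` of `Summits/NavierStokesRegularity/…/L3TimeExponentPincer*.lean` discharges.

## References

* V. G. Maz'ja, *Sobolev Spaces*, Springer Series in Soviet Mathematics (1985), §1.4.2, Theorems 1–2
  (trace inequality), §1.2.1 Theorem 2 and Lemma (boxing, relative isoperimetry), §1.2.3 (layer cake),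
  §1.2.4 (co-area).
* W. Gustin, *Boxing inequalities*, J. Math. Mech. 9 (1960) 533–536.
-/

noncomputable section

open MeasureTheory Set Function Filter Metric
open scoped ENNReal NNReal Topology

namespace Literature.Analysis.FunctionSpaces

/-! ### The boxing inequality at the level-set surrogate -/

/-- Finite superadditivity of `levelPerimeter u t` over pairwise disjoint balls, in the shape consumed
by the abstract boxing inequality (from `tsum_levelPerimeter_le`).
[cite: Mazja1985, §1.2.4 Theorem (co-area formula) — smooth level-set surrogate] -/
theorem finset_sum_levelPerimeter_ball_le (u : EuclideanSpace ℝ (Fin 3) → ℝ) (t : ℝ)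
    (F : Finset (EuclideanSpace ℝ (Fin 3))) (ρ : EuclideanSpace ℝ (Fin 3) → ℝ)
    (hd : (F : Set (EuclideanSpace ℝ (Fin 3))).PairwiseDisjoint fun x => ball x (ρ x)) :
    ∑ x ∈ F, levelPerimeter u t (ball x (ρ x)) ≤ levelPerimeter u t univ := by
  have hd' : Pairwise (Disjoint on fun i : F => ball (i : EuclideanSpace ℝ (Fin 3)) (ρ i)) :=
    fun i j hij => hd i.2 j.2 fun h => hij (Subtype.ext h)
  calc ∑ x ∈ F, levelPerimeter u t (ball x (ρ x))
      = ∑ i : F, levelPerimeter u t (ball (i : EuclideanSpace ℝ (Fin 3)) (ρ i)) :=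
        (Finset.sum_coe_sort F _).symm
    _ = ∑' i : F, levelPerimeter u t (ball (i : EuclideanSpace ℝ (Fin 3)) (ρ i)) :=
        (tsum_fintype _).symm
    _ ≤ levelPerimeter u t (⋃ i : F, ball (i : EuclideanSpace ℝ (Fin 3)) (ρ i)) :=
        tsum_levelPerimeter_le u t (fun _ => measurableSet_ball) hd'
    _ ≤ levelPerimeter u t univ := levelPerimeter_mono u t (subset_univ _)

/-- **Boxing inequality for superlevel sets of smooth functions, surrogate form** (Maz'ja 1985 §1.4.2
Thm 2 with §1.2.1 Thm 2: Gustin's covering argument + the relative isoperimetric inequality): there is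
`c < ∞` such that for every measurable `g ≥ 0` with `∫_{B(x,r)} g ≤ K r²` on all balls, every
`u ∈ C¹(ℝ³)` with compact support and every level `t > 0`, `∫_{u > t} g ≤ c · K · levelPerimeter u t ℝ³`.
(`{u > t}` is open and, as `t > 0`, inside the support of `u`, hence bounded.)
[cite: Mazja1985, §1.4.2 Theorem 2 with §1.2.1 Theorem 2 (boxing step)] -/
theorem setLIntegral_superlevel_le_levelPerimeter :
    ∃ c : ℝ≥0∞, c ≠ ⊤ ∧ ∀ g : EuclideanSpace ℝ (Fin 3) → ℝ≥0∞, Measurable g → ∀ K : ℝ≥0,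
      BallGrowthTwo g K → ∀ u : EuclideanSpace ℝ (Fin 3) → ℝ, ContDiff ℝ 1 u → HasCompactSupport u →
        ∀ t : ℝ, 0 < t → ∫⁻ y in {y | t < u y}, g y ≤ c * K * levelPerimeter u t univ := by
  obtain ⟨C₂, hC₂⟩ := exists_nnreal_min_measure_superlevel_ball_le_levelPerimeter
  refine ⟨ENNReal.ofReal 8 * C₂, ENNReal.mul_ne_top ENNReal.ofReal_ne_top ENNReal.coe_ne_top,
    fun g _ K hK u hu huc t ht => ?_⟩
  have hEo : IsOpen {y | t < u y} := isOpen_lt continuous_const hu.continuous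
  have hEb : Bornology.IsBounded {y | t < u y} := by
    refine huc.isCompact.isBounded.subset fun y hy => subset_tsupport u ?_
    rw [mem_support]
    exact (ht.trans hy).ne'
  have h := setLIntegral_le_of_ballGrowthTwo_of_relIsoperimetric hEo hEb hK (levelPerimeter u t)
    one_pos (C₂ := C₂)
    (fun F ρ _ hd => finset_sum_levelPerimeter_ball_le u t F ρ hd)
    (fun x _ r hr => by simpa only [one_mul] using hC₂ u hu x r hr t)
  calc ∫⁻ y in {y | t < u y}, g y
      ≤ ENNReal.ofReal (8 * 1 ^ 2) * C₂ * K * levelPerimeter u t univ := h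
    _ = ENNReal.ofReal 8 * C₂ * K * levelPerimeter u t univ := by norm_num

/-! ### Assembly -/

/-- One half of the layer decomposition: the boxing inequality at each level `t > 0` integrated
against the co-area inequality for the surrogate gives `∫⁻_{t>0} ∫_{u>t} g ≤ c K ∫ ‖Du‖` for
`u ∈ C¹_c`. [cite: Mazja1985, §1.4.2 Theorem 1 proof, display after (3)] -/
theorem lintegral_Ioi_setLIntegral_superlevel_le {c : ℝ≥0∞}
    (hB : ∀ g : EuclideanSpace ℝ (Fin 3) → ℝ≥0∞, Measurable g → ∀ K : ℝ≥0,
      BallGrowthTwo g K → ∀ u : EuclideanSpace ℝ (Fin 3) → ℝ, ContDiff ℝ 1 u → HasCompactSupport u →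
        ∀ t : ℝ, 0 < t → ∫⁻ y in {y | t < u y}, g y ≤ c * K * levelPerimeter u t univ)
    {g : EuclideanSpace ℝ (Fin 3) → ℝ≥0∞} (hg : Measurable g) {K : ℝ≥0} (hK : BallGrowthTwo g K)
    {u : EuclideanSpace ℝ (Fin 3) → ℝ} (hu : ContDiff ℝ 1 u) (huc : HasCompactSupport u) :
    ∫⁻ t in Ioi (0 : ℝ), ∫⁻ y in {y | t < u y}, g y ≤ c * K * ∫⁻ x, ‖fderiv ℝ u x‖ₑ := by
  calc ∫⁻ t in Ioi (0 : ℝ), ∫⁻ y in {y | t < u y}, g y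
      ≤ ∫⁻ t in Ioi (0 : ℝ), c * K * levelPerimeter u t univ :=
        setLIntegral_mono' measurableSet_Ioi fun t ht => hB g hg K hK u hu huc t ht
    _ = c * K * ∫⁻ t in Ioi (0 : ℝ), levelPerimeter u t univ := by
        rw [lintegral_const_mul _ (measurable_levelPerimeter hu univ)]
    _ ≤ c * K * ∫⁻ x, ‖fderiv ℝ u x‖ₑ := by
        gcongr
        exact lintegral_Ioi_levelPerimeter_univ_le hu

/-- **Maz'ya's trace inequality from a boxing inequality** (assembly of Maz'ja 1985 §1.4.2 Thm 2 with
Thm 1, `q = 1`, `n = 3`): layer cake `∫ g|w| = ∫₀^∞ μ_g{|w| > t} dt`, the split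
`{|w| > t} ⊆ {w > t} ∪ {-w > t}`, the boxing inequality (hypothesis `hB`, constant `c < ∞`) for `w` and
`-w` at each level, and the co-area inequality for the level-set perimeter surrogate; the trace
constant is `2c`. [cite: Mazja1985, §1.4.2 Theorem 2 (11)–(12) with Theorem 1 (2); q = 1, n = 3, μ = g dx] -/
theorem mazyaTraceD_of_levelBoxing {c : ℝ≥0∞} (hct : c ≠ ⊤)
    (hB : ∀ g : EuclideanSpace ℝ (Fin 3) → ℝ≥0∞, Measurable g → ∀ K : ℝ≥0,
      BallGrowthTwo g K → ∀ u : EuclideanSpace ℝ (Fin 3) → ℝ, ContDiff ℝ 1 u → HasCompactSupport u →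
        ∀ t : ℝ, 0 < t → ∫⁻ y in {y | t < u y}, g y ≤ c * K * levelPerimeter u t univ) :
    MazyaTraceD := by
  refine ⟨(2 * c).toNNReal, fun g hg K hK w hw hwc => ?_⟩
  -- smoothness bookkeeping
  have hw1 : ContDiff ℝ 1 w := hw.of_le (by exact_mod_cast le_top)
  have hnw1 : ContDiff ℝ 1 (-w) := hw1.neg
  have hnwc : HasCompactSupport (-w) := hwc.neg
  have hwm : Measurable fun x => ‖w x‖ := hw.continuous.norm.measurable
  have hwme : Measurable fun x => ‖w x‖ₑ := hw.continuous.measurable.enorm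
  -- the constant
  have h2c : ((2 * c).toNNReal : ℝ≥0∞) = 2 * c :=
    ENNReal.coe_toNNReal (ENNReal.mul_ne_top (by norm_num) hct)
  rw [h2c]
  -- layer cake for the measure `g dx`
  set μ : Measure (EuclideanSpace ℝ (Fin 3)) := volume.withDensity g with hμ
  have hlayer : ∫⁻ x, g x * ‖w x‖ₑ = ∫⁻ t in Ioi (0 : ℝ), μ {x | t < ‖w x‖} := by
    have h1 : ∫⁻ x, g x * ‖w x‖ₑ = ∫⁻ x, ‖w x‖ₑ ∂μ := by
      rw [hμ, lintegral_withDensity_eq_lintegral_mul _ hg hwme]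
      rfl
    have h2 : ∫⁻ x, ‖w x‖ₑ ∂μ = ∫⁻ x, ENNReal.ofReal ‖w x‖ ∂μ :=
      lintegral_congr fun x => (ofReal_norm (w x)).symm
    rw [h1, h2]
    exact lintegral_eq_lintegral_meas_lt μ (Eventually.of_forall fun x => norm_nonneg _)
      hwm.aemeasurable
  -- at each level `t > 0`: `μ{|w| > t} ≤ ∫_{w > t} g + ∫_{-w > t} g`
  have hlevel : ∀ t : ℝ, 0 < t →
      μ {x | t < ‖w x‖} ≤ (∫⁻ y in {y | t < w y}, g y) + ∫⁻ y in {y | t < (-w) y}, g y := by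
    intro t _
    have hms : MeasurableSet {x | t < ‖w x‖} := measurableSet_lt measurable_const hwm
    rw [hμ, withDensity_apply _ hms]
    have hsub : {x | t < ‖w x‖} ⊆ {y | t < w y} ∪ {y | t < (-w) y} := by
      intro x hx
      simp only [mem_setOf_eq, Real.norm_eq_abs] at hx
      rcases lt_abs.1 hx with h | h
      · exact Or.inl h
      · exact Or.inr (by simpa using h)
    exact (lintegral_mono_set hsub).trans (lintegral_union_le _ _ _)
  -- integrate in `t` and use the boxing + co-area inequalities for `w` and `-w`
  have hmeas1 : Measurable fun t : ℝ => ∫⁻ y in {y | t < w y}, g y := by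
    refine Antitone.measurable fun s t hst => lintegral_mono_set fun y (hy : t < w y) => ?_
    exact lt_of_le_of_lt hst hy
  calc ∫⁻ x, g x * ‖w x‖ₑ = ∫⁻ t in Ioi (0 : ℝ), μ {x | t < ‖w x‖} := hlayer
    _ ≤ ∫⁻ t in Ioi (0 : ℝ), ((∫⁻ y in {y | t < w y}, g y) + ∫⁻ y in {y | t < (-w) y}, g y) :=
        setLIntegral_mono' measurableSet_Ioi fun t ht => hlevel t ht
    _ = (∫⁻ t in Ioi (0 : ℝ), ∫⁻ y in {y | t < w y}, g y) +
          ∫⁻ t in Ioi (0 : ℝ), ∫⁻ y in {y | t < (-w) y}, g y := lintegral_add_left hmeas1 _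
    _ ≤ (c * K * ∫⁻ x, ‖fderiv ℝ w x‖ₑ) + c * K * ∫⁻ x, ‖fderiv ℝ (-w) x‖ₑ :=
        add_le_add (lintegral_Ioi_setLIntegral_superlevel_le hB hg hK hw1 hwc)
          (lintegral_Ioi_setLIntegral_superlevel_le hB hg hK hnw1 hnwc)
    _ = 2 * c * K * ∫⁻ x, ‖fderiv ℝ w x‖ₑ := by
        have : (fun x => ‖fderiv ℝ (-w) x‖ₑ) = fun x => ‖fderiv ℝ w x‖ₑ := by
          funext x; rw [fderiv_neg, enorm_neg]
        rw [this]; ring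

/-- **Maz'ya's trace inequality on `ℝ³`, `q = 1`, `n = 3`, `μ = g dx` — discharge of the named fact
`MazyaTraceD`**: there is an absolute constant `c` such that for every measurable `g ≥ 0` with
`∫_{B(x,r)} g ≤ K r²` for all balls and every smooth compactly supported `w`,
`∫ g |w| ≤ c · K · ∫ |∇w|`.  Proof: `mazyaTraceD_of_levelBoxing` with the boxing inequality
`setLIntegral_superlevel_le_levelPerimeter` (Gustin/Vitali covering + relative isoperimetry in balls
from the `p = 1` Poincaré inequality), all on the level-set perimeter surrogate `levelPerimeter`.
[cite: Mazja1985, §1.4.2 Theorem 2 (11)–(12) with Theorem 1 (2); q = 1, n = 3, μ = g dx] -/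
theorem MazyaTraceD_holds : MazyaTraceD := by
  obtain ⟨c, hct, hB⟩ := setLIntegral_superlevel_le_levelPerimeter
  exact mazyaTraceD_of_levelBoxing hct hB

end Literature.Analysis.FunctionSpaces

end
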